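import Literature.Analysis.FunctionSpaces.SobolevBallScaling
import Mathlib.MeasureTheory.Function.LpSpace.Complete
import Mathlib.Topology.MetricSpace.Sequences
import HarnessLib

/-!
# Route `LerayQuarterDissipation`, item `RecurrentReductionD` (stmt-NavierStokesRegularity-22507):
# the Sobolev inequality modulo constants on `ℝ³`

Helper file (theorems only, `--supports` the item). The finite-dissipation stratum `𝒟` of the
route is cut out of the Type-I ancient mild class by the slice-wise law `∫‖∇w(s)‖² ≤ K/√(−s)`.
To convert square-integrability of the GRADIENT of a bounded smooth slice into integrability of
the slice itself one needs the homogeneous Sobolev inequality on the whole space for functions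
which are NOT known to decay: for a three-dimensional real inner product space `E`, a
finite-dimensional `F` and a bounded `C¹` map `f : E → F` with `∇f ∈ L²(E)` there is a
constant vector `b` (the "value of `f` at infinity") with

  `‖f − b‖_{L⁶(E)} ≤ C_S ‖∇f‖_{L²(E)}`,  `‖b‖ ≤ sup ‖f‖`

(`exists_sub_const_eLpNorm_six_le`), `C_S = C_S(E)`. Proof: the scale-invariant
Sobolev–Poincaré inequality on balls (`exists_eLpNorm_sub_average_le_ball`, tree:
`‖f − ⨍_B f‖_{L⁶(B)} ≤ C ‖∇f‖_{L²(B)}` with `C` independent of the ball) bounds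
`‖f − a_n‖_{L⁶(B(0,n+1))}` by `C‖∇f‖_{L²(E)}` for the ball averages `a_n`; the averages are
bounded by `sup ‖f‖`, so a subsequence converges to some `b` (Bolzano–Weierstrass in `F`), and
Fatou (`eLpNorm_lim_le_liminf_eLpNorm`) followed by monotone convergence over the exhausting
balls gives the inequality on all of `E`.

References: L. C. Evans, *Partial Differential Equations*, 2nd ed. (2010), §5.6.1, §5.8.1;
E. H. Lieb, M. Loss, *Analysis*, 2nd ed. (2001), Thm. 8.3 (Sobolev's inequality for gradients,
`D^{1}(ℝ³) ⊂ L⁶`).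
-/

noncomputable section

-- the summit and its single problem share the name (D-0017 nested layout)
set_option linter.dupNamespace false

namespace Summit.NavierStokesRegularity.NavierStokesRegularity.Theorems.RecurrentReductionD

open MeasureTheory Set Function Filter Topology Metric TopologicalSpace
open Literature.Analysis.FunctionSpaces
open scoped ENNReal NNReal

variable {E : Type*} [NormedAddCommGroup E] [InnerProductSpace ℝ E] [FiniteDimensional ℝ E]
  [MeasurableSpace E] [BorelSpace E]
variable {F : Type*} [NormedAddCommGroup F] [NormedSpace ℝ F] [FiniteDimensional ℝ F]

omit [FiniteDimensional ℝ F] in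
/-- The average of a function bounded by `M` over a ball has norm at most `M`. -/
theorem norm_setAverage_ball_le {f : E → F} {M : ℝ} (hM : ∀ x, ‖f x‖ ≤ M) (x₀ : E) {r : ℝ}
    (hr : 0 < r) : ‖⨍ y in ball x₀ r, f y‖ ≤ M := by
  have hM0 : 0 ≤ M := (norm_nonneg _).trans (hM x₀)
  have hV0 : volume (ball x₀ r) ≠ 0 := (measure_ball_pos volume x₀ hr).ne'
  have hVt : volume (ball x₀ r) ≠ ⊤ := measure_ball_lt_top.ne
  have hreal : 0 < volume.real (ball x₀ r) := ENNReal.toReal_pos hV0 hVt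
  rw [setAverage_eq, norm_smul, Real.norm_of_nonneg (inv_nonneg.2 hreal.le)]
  have hint : ‖∫ y in ball x₀ r, f y‖ ≤ M * volume.real (ball x₀ r) :=
    norm_setIntegral_le_of_norm_le_const measure_ball_lt_top fun y _ => hM y
  calc (volume.real (ball x₀ r))⁻¹ * ‖∫ y in ball x₀ r, f y‖
      ≤ (volume.real (ball x₀ r))⁻¹ * (M * volume.real (ball x₀ r)) :=
        mul_le_mul_of_nonneg_left hint (inv_nonneg.2 hreal.le)
    _ = M := by field_simp

/-- **Sobolev–Poincaré on every ball for a bounded `C¹` map with `∇f ∈ L²`** (`dim E = 3`):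
`‖f − ⨍_B f‖_{L⁶(B)} ≤ C ‖∇f‖_{L²(E)}` on every ball `B`, `C = C(E)` (the tree's
`exists_eLpNorm_sub_average_le_ball`; the classical gradient is a weak gradient,
`HasWeakFDerivOn.of_contDiff_holds`). -/
theorem exists_eLpNorm_sub_average_ball_le_of_contDiff (hE : Module.finrank ℝ E = 3) :
    ∃ C : ℝ≥0, ∀ (f : E → F), ContDiff ℝ 1 f → (∃ M : ℝ, ∀ x, ‖f x‖ ≤ M) →
      MemLp (fderiv ℝ f) 2 volume → ∀ (x₀ : E) (r : ℝ), 0 < r →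
      eLpNorm (fun x => f x - ⨍ y in ball x₀ r, f y) 6 (volume.restrict (ball x₀ r)) ≤
        C * eLpNorm (fderiv ℝ f) 2 volume := by
  obtain ⟨C, hC⟩ := exists_eLpNorm_sub_average_le_ball (E := E) (F := F) (p := 2) (p' := 6)
    one_le_two (by rw [hE]; norm_num) (by rw [hE]; norm_num)
  refine ⟨C, fun f hf hbd hDf x₀ r hr => ?_⟩
  obtain ⟨M, hM⟩ := hbd
  set B : Opens E := ⟨ball x₀ r, isOpen_ball⟩ with hB
  haveI : IsFiniteMeasure (volume.restrict (ball x₀ r)) :=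
    isFiniteMeasure_restrict.2 measure_ball_lt_top.ne
  have hw : HasWeakFDerivOn B volume f (fderiv ℝ f) := HasWeakFDerivOn.of_contDiff_holds _ volume hf
  have hf2 : MemLp f 2 (volume.restrict (ball x₀ r)) :=
    MemLp.of_bound hf.continuous.aestronglyMeasurable M (Eventually.of_forall hM)
  have hDf2 : MemLp (fderiv ℝ f) 2 (volume.restrict (ball x₀ r)) := hDf.restrict _
  have hsob : MemSobolevDomain 1 ((2 : ℝ≥0) : ℝ≥0∞) B volume f := by
    refine memSobolevDomain_succ_iff.2 ⟨by exact_mod_cast hf2, fderiv ℝ f, hw, fun v => ?_⟩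
    rw [memSobolevDomain_zero_iff]
    exact_mod_cast (ContinuousLinearMap.apply ℝ F v).comp_memLp' hDf2
  have key := hC x₀ r hr f (fderiv ℝ f) hsob hw
  refine (by exact_mod_cast key : eLpNorm (fun x => f x - ⨍ y in ball x₀ r, f y) 6
      (volume.restrict (ball x₀ r)) ≤ C * eLpNorm (fderiv ℝ f) 2 (volume.restrict (ball x₀ r))).trans ?_
  gcongr
  exact Measure.restrict_le_self

omit [NormedSpace ℝ F] [FiniteDimensional ℝ F] in
/-- From a bound on all the balls `B(0, m+1)` to the whole space: if
`‖g‖_{L⁶(B(0,m+1))} ≤ A` for every `m`, then `‖g‖_{L⁶(E)} ≤ A` (monotone convergence over the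
exhausting balls, `setLIntegral_iUnion_of_directed`). -/
theorem eLpNorm_six_le_of_forall_ball {g : E → F} {A : ℝ≥0∞}
    (h : ∀ m : ℕ, eLpNorm g 6 (volume.restrict (ball (0 : E) ((m : ℝ) + 1))) ≤ A) :
    eLpNorm g 6 volume ≤ A := by
  have h6 : (6 : ℝ≥0∞) ≠ 0 := by norm_num
  have h6' : (6 : ℝ≥0∞) ≠ ⊤ := by norm_num
  have htR : (6 : ℝ≥0∞).toReal = 6 := by norm_num
  have hball : ∀ m : ℕ, (∫⁻ x in ball (0 : E) ((m : ℝ) + 1), ‖g x‖ₑ ^ (6 : ℝ)) ≤ A ^ (6 : ℝ) := by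
    intro m
    have hm := h m
    rw [eLpNorm_eq_lintegral_rpow_enorm_toReal h6 h6', htR, one_div,
      ENNReal.rpow_inv_le_iff (by norm_num : (0 : ℝ) < 6)] at hm
    exact hm
  have hdir : Directed (· ⊆ ·) fun m : ℕ => ball (0 : E) ((m : ℝ) + 1) := by
    refine Monotone.directed_le fun m n hmn => ball_subset_ball ?_
    exact_mod_cast Nat.add_le_add_right hmn 1
  have hunion : (⋃ m : ℕ, ball (0 : E) ((m : ℝ) + 1)) = univ := iUnion_ball_nat_succ 0
  rw [eLpNorm_eq_lintegral_rpow_enorm_toReal h6 h6', htR, one_div,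
    ENNReal.rpow_inv_le_iff (by norm_num : (0 : ℝ) < 6), ← setLIntegral_univ, ← hunion,
    setLIntegral_iUnion_of_directed _ hdir]
  exact iSup_le hball

/-- **The Sobolev inequality modulo constants on a three-dimensional space.** For a bounded
`C¹` map `f : E → F` (`dim E = 3`, `F` finite-dimensional) with `∇f ∈ L²(E)` there is a
constant `b ∈ F` with `‖b‖ ≤ sup‖f‖` and `‖f − b‖_{L⁶(E)} ≤ C_S ‖∇f‖_{L²(E)}`, `C_S = C_S(E)`:
ball averages `a_m = ⨍_{B(0,m+1)} f` satisfy `‖f − a_m‖_{L⁶(B(0,m+1))} ≤ C_S‖∇f‖₂`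
(`exists_eLpNorm_sub_average_ball_le_of_contDiff`), a subsequence of the bounded sequence `a_m`
converges to some `b` (Bolzano–Weierstrass), Fatou on each ball and monotone convergence. -/
theorem exists_sub_const_eLpNorm_six_le (hE : Module.finrank ℝ E = 3) :
    ∃ C : ℝ≥0, ∀ (f : E → F), ContDiff ℝ 1 f → ∀ M : ℝ, (∀ x, ‖f x‖ ≤ M) →
      MemLp (fderiv ℝ f) 2 volume →
      ∃ b : F, ‖b‖ ≤ M ∧
        eLpNorm (fun x => f x - b) 6 volume ≤ C * eLpNorm (fderiv ℝ f) 2 volume := by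
  obtain ⟨C, hC⟩ := exists_eLpNorm_sub_average_ball_le_of_contDiff (E := E) (F := F) hE
  refine ⟨C, fun f hf M hM hDf => ?_⟩
  -- the ball averages and their bound
  set a : ℕ → F := fun m => ⨍ y in ball (0 : E) ((m : ℝ) + 1), f y with ha
  have habd : ∀ m, a m ∈ closedBall (0 : F) M := fun m =>
    mem_closedBall_zero_iff.2 (norm_setAverage_ball_le hM 0 (by positivity))
  -- Bolzano–Weierstrass
  obtain ⟨b, hb, ψ, hψ, hlim⟩ := tendsto_subseq_of_bounded isBounded_closedBall habd
  rw [isClosed_closedBall.closure_eq, mem_closedBall_zero_iff] at hb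
  refine ⟨b, hb, eLpNorm_six_le_of_forall_ball fun m => ?_⟩
  -- Fatou on the ball `B(0, m+1)`
  set μ : Measure E := volume.restrict (ball (0 : E) ((m : ℝ) + 1)) with hμ
  have hmeas : ∀ j, AEStronglyMeasurable (fun x => f x - a (ψ j)) μ := fun j =>
    (hf.continuous.sub continuous_const).aestronglyMeasurable
  have hpt : ∀ᵐ x ∂μ, Tendsto (fun j => f x - a (ψ j)) atTop (𝓝 (f x - b)) :=
    Eventually.of_forall fun x => tendsto_const_nhds.sub hlim
  refine (Lp.eLpNorm_lim_le_liminf_eLpNorm hmeas (fun x => f x - b) hpt).trans ?_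
  refine liminf_le_of_frequently_le' (((eventually_ge_atTop m).mono fun j hj => ?_).frequently)
  have hle : (m : ℝ) + 1 ≤ ((ψ j : ℕ) : ℝ) + 1 := by
    have h1 : m ≤ ψ j := hj.trans (hψ.id_le j)
    exact_mod_cast Nat.add_le_add_right h1 1
  calc eLpNorm (fun x => f x - a (ψ j)) 6 μ
      ≤ eLpNorm (fun x => f x - a (ψ j)) 6
          (volume.restrict (ball (0 : E) (((ψ j : ℕ) : ℝ) + 1))) :=
        eLpNorm_mono_measure _ (Measure.restrict_mono (ball_subset_ball hle) le_rfl)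
    _ ≤ C * eLpNorm (fderiv ℝ f) 2 volume := hC f hf ⟨M, hM⟩ hDf 0 _ (by positivity)

end Summit.NavierStokesRegularity.NavierStokesRegularity.Theorems.RecurrentReductionD

end
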